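/-
Copyright (c) 2026. Released under Apache 2.0 license as described in the file LICENSE.
-/
import Summits.RiemannHypothesis.RiemannHypothesis.Theorems.LiDirichletKernelTaylor
import Summits.RiemannHypothesis.RiemannHypothesis.Theorems.LiDirichletKernelTrend
import Summits.RiemannHypothesis.RiemannHypothesis.Theorems.LiDirichletSplit
import HarnessLib

/-!
# KERNEL LINEAGE K-χ — soundness IV: what `runModulus … = true` proves

RH-FREE DATA machinery.  bears_on: LADDER-RH L-D (Dirichlet rows; consumers
`Literature/NumberTheory/LFunctions/LiCriterionDirichlet.lean:95/194`).  WHAT THIS IS NOT: a table of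
`λ_χ(n)`, `n ≤ 48`, is not evidence for GRH, and `Re λ_χ(n) > 0` for `n ≤ 48` is not Li's `∀ n` criterion;
nothing here bears on the truth of RH or GRH.

`runModulus_sound`: if the kernel evaluates `runModulus q ms primes facs tr0 tr1 chars` to `true`, then for
every `CharSpec` `c` of `chars` and every Dirichlet character `χ mod q` MATCHING it (`CharMatches`: `χ ≠ 1`, the
parity, the values `χ(m) = e(t_m/d)` along the unit residues `ms`, `χ = 0` off `ms`) and every `1 ≤ n ≤ 48`:
`lb_χ(n) + lt_χ(n)` lies in the `λ`-row `n` of `c`, `lt_χ(n) = charLiOsc χ n` in its `lt`-row, and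
`lb_χ(n) + lt_χ(n) > 0`; and the trend rows `tr0`/`tr1` (when non-empty) enclose `lb_χ(n) = charLiTrend χ n`
for every `χ mod q` of that parity.  For PRIMITIVE `χ` (`q > 1`) the first quantity IS
`Re λ_χ(n) = LiDirichlet.liCoeffCharRe χ n` by T-D2s `liDirichletSplit_holds` (`liCoeffCharRe_mem_row_of_cert`).
-/

set_option linter.dupNamespace false

namespace Summit.RiemannHypothesis.RiemannHypothesis.Theorems.LiDirichletKernel

open Literature.Analysis.ValidatedNumerics Literature.Analysis.ValidatedNumerics.NumericsMP
open Literature.NumberTheory.LFunctions Literature.NumberTheory.LFunctions.Xiao2020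
open Literature.NumberTheory.LFunctions.Xiao2020.CertKernel
open Literature.NumberTheory.LFunctions.DirichletLTaylor Literature.NumberTheory.LFunctions.LiDirichlet
open Summit.RiemannHypothesis.RiemannHypothesis.Theorems.LiKernel
open Summit.RiemannHypothesis.RiemannHypothesis.Theorems.LiTheory
open Finset
open scoped Nat

/-! ## Reading the table checks -/

/-- `x ∈ [l, h]·10^{−d}`. -/
def InRow (x : ℝ) (d : ℕ) (l h : ℤ) : Prop := (l : ℝ) / 10 ^ d ≤ x ∧ x ≤ (h : ℝ) / 10 ^ d

/-- Row `n` (`1 ≤ n`) of a table of rows (junk `0`s beyond its length). -/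
def rowOf {α : Type*} [Inhabited α] (rows : List α) (n : ℕ) : α := rows.getD (n - 1) default

/-- What `rowOKχ … = true` says. -/
theorem rowOKχ_sound {S : ℕ} (hS : 0 < S) {x y : ℝ} {L O : MI} (hx : MI.mem S x L) (hy : MI.mem S y O)
    {r : ℕ × ℤ × ℤ × ℤ × ℤ} (h : rowOKχ S L O r = true) :
    InRow x r.1 r.2.1 r.2.2.1 ∧ InRow y r.1 r.2.2.2.1 r.2.2.2.2 ∧ 0 < x := by
  simp only [rowOKχ, Bool.and_eq_true, decide_eq_true_eq] at h
  obtain ⟨⟨⟨⟨h1, h2⟩, h3⟩, h4⟩, h5⟩ := h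
  exact ⟨bounds_of_test hS hx h1 h2, bounds_of_test hS hy h3 h4, MI.pos_of_lo_pos hx h5⟩

/-- What `checkRowsχ … = true` says, entry by entry. -/
theorem checkRowsχ_spec (S : ℕ) : ∀ (T : List (ℕ × ℤ × ℤ × ℤ × ℤ)) (Ls Os : List MI),
    checkRowsχ S Ls Os T = true → Ls.length = T.length ∧ Os.length = T.length ∧
      ∀ i < T.length, rowOKχ S (Ls.getD i zeroI) (Os.getD i zeroI) (T.getD i default) = true
  | [], Ls, Os, h => by
    cases Ls with
    | nil =>
      cases Os with
      | nil => simp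
      | cons O Os => simp [checkRowsχ] at h
    | cons L Ls => simp [checkRowsχ] at h
  | r :: rs, Ls, Os, h => by
    cases Ls with
    | nil => simp [checkRowsχ] at h
    | cons L Ls =>
      cases Os with
      | nil => simp [checkRowsχ] at h
      | cons O Os =>
        simp only [checkRowsχ, Bool.and_eq_true] at h
        obtain ⟨hr, hrest⟩ := h
        obtain ⟨hl1, hl2, hrows⟩ := checkRowsχ_spec S rs Ls Os hrest
        refine ⟨by simp [hl1], by simp [hl2], fun i hi ↦ ?_⟩
        cases i with
        | zero => simpa using hr
        | succ i => simpa using hrows i (by simpa using hi)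

/-- What `boxOK … = true` says. -/
theorem boxOK_sound {S : ℕ} (hS : 0 < S) {x : ℝ} {I : MI} (hx : MI.mem S x I) {r : ℕ × ℤ × ℤ}
    (h : boxOK S I r = true) : InRow x r.1 r.2.1 r.2.2 := by
  simp only [boxOK, Bool.and_eq_true, decide_eq_true_eq] at h
  exact bounds_of_test hS hx h.1 h.2

/-- What `checkBoxes … = true` says, entry by entry. -/
theorem checkBoxes_spec (S : ℕ) : ∀ (T : List (ℕ × ℤ × ℤ)) (Is : List MI),
    checkBoxes S Is T = true → Is.length = T.length ∧ ∀ i < T.length, boxOK S (Is.getD i zeroI) (T.getD i default) = true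
  | [], Is, h => by
    cases Is with
    | nil => simp
    | cons I Is => simp [checkBoxes] at h
  | r :: rs, Is, h => by
    cases Is with
    | nil => simp [checkBoxes] at h
    | cons I Is =>
      simp only [checkBoxes, Bool.and_eq_true] at h
      obtain ⟨hl, hrows⟩ := checkBoxes_spec S rs Is h.2
      refine ⟨by simp [hl], fun i hi ↦ ?_⟩
      cases i with
      | zero => simpa using h.1
      | succ i => simpa using hrows i (by simpa using hi)

/-! ## The hypotheses tying a character and a modulus to the certificate data -/

/-- The character `χ mod q` MATCHES the `CharSpec` `c` along the residue list `ms`: `χ ≠ 1`, parity `c.parity`,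
`χ(m_k) = e(t_k/d)` for the listed residues, and `χ(m) = 0` for every other `m < q`. -/
structure CharMatches (q : ℕ) [NeZero q] (ms : List ℕ) (c : CharSpec) (χ : DirichletCharacter ℂ q) : Prop where
  /-- `χ` is not principal -/
  ne_one : χ ≠ 1
  /-- the parity -/
  parity : charParity χ = c.parity
  /-- the denominator is positive -/
  d_pos : 0 < c.d
  /-- one exponent per listed residue -/
  tab_length : c.tab.length = ms.length
  /-- the values at the listed residues -/
  values : ∀ k < ms.length, χ ((ms.getD k 0 : ℕ) : ZMod q) = rootOfUnity c.d (c.tab.getD k 0)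
  /-- `χ` vanishes off the list -/
  vanishes : ∀ m < q, m ∉ ms → χ (m : ZMod q) = 0

/-- The modulus data are sane: `q > 1`, the residue list has no duplicates and lies in `[1, q)`, and the
factorisation table reaches `(N+1)q`. -/
structure ModulusOK (q : ℕ) (ms : List ℕ) (facs : List (List (ℕ × ℕ))) : Prop where
  /-- `q > 1` -/
  one_lt : 1 < q
  /-- no duplicates -/
  nodup : ms.Nodup
  /-- residues in `[1, q)` -/
  range : ∀ m ∈ ms, 1 ≤ m ∧ m < q
  /-- enough factorisations -/
  facs_length : NK * q + q ≤ facs.length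

/-! ## Soundness of the modulus certificate -/

/-- `26 ≤ 30`: the coefficient table is long enough for the `ζ(j)` program. -/
private theorem emCoeffTable_length : NUZ + 1 ≤ emCoeffTable.length := by decide

variable {q : ℕ} [NeZero q]

/-- Positions of a list are members. -/
private theorem getD_mem {ms : List ℕ} {k : ℕ} (hk : k < ms.length) : ms.getD k 0 ∈ ms := by
  rw [List.getD_eq_getElem _ _ hk]; exact List.getElem_mem hk

/-- The `charCheck` of one character, given valid shared data. -/
private theorem charCheck_sound {ms : List ℕ} {facs : List (List (ℕ × ℕ))} (hmod : ModulusOK q ms facs)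
    {PI : MI} (hPI : MI.mem SK Real.pi PI) {Ls : List MI}
    (hLs : Encl SK (fun i ↦ Real.log ((i + 1 : ℕ) : ℝ)) Ls) (hLsl : Ls.length = facs.length)
    {Tr0 Tr1 : List MI}
    (hTr : ∀ χ : DirichletCharacter ℂ q, Encl SK (fun j ↦ charLiTrend χ (1 + j))
      (pickTrend (charParity χ) Tr0 Tr1))
    {c : CharSpec} (h : charCheck q PI (allProgCoeffs SK EK LEN q NK NUK emCoeffTable Ls ms) Tr0 Tr1 c = true)
    {χ : DirichletCharacter ℂ q} (hχ : CharMatches q ms c χ) {n : ℕ} (hn : 1 ≤ n) (hn' : n ≤ IMAX) :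
    InRow (charLiTrend χ n + charLiOsc χ n) (rowOf c.rows n).1 (rowOf c.rows n).2.1 (rowOf c.rows n).2.2.1 ∧
      InRow (charLiOsc χ n) (rowOf c.rows n).1 (rowOf c.rows n).2.2.2.1 (rowOf c.rows n).2.2.2.2 ∧
      0 < charLiTrend χ n + charLiOsc χ n := by
  have hS : 0 < SK := by simp [SK]
  have hq : 0 < q := by have := hmod.one_lt; omega
  unfold charCheck at h
  split at h
  · rename_i V hV
    split at h
    · rename_i Q hQ
      -- the character values
      obtain ⟨hVl, hVe⟩ := charVals_spec hS hPI hχ.d_pos c.tab V hV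
      rw [hχ.tab_length] at hVl
      have hVχ : EnclC SK (fun k ↦ χ ((ms.getD k 0 : ℕ) : ZMod q)) V :=
        hVe.congr fun k hk ↦ by rw [hχ.values k (by omega)]
      -- the per-residue coefficient lists
      set Cs := allProgCoeffs SK EK LEN q NK NUK emCoeffTable Ls ms with hCs
      have hCsl : Cs.length = ms.length := by simp [hCs, allProgCoeffs]
      have hget : ∀ k < ms.length,
          Cs.getD k [] = progCoeffs SK EK LEN q (ms.getD k 0) NK NUK emCoeffTable (pochRows NUK) Ls := by
        intro k hk
        rw [hCs, allProgCoeffs, List.getD_eq_getElem?_getD, List.getElem?_map, List.getElem?_eq_getElem hk,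
          Option.map_some, Option.getD_some, List.getD_eq_getElem _ _ hk]
      have hcs : ∀ j < NUK, emCoeffTable.getD (j + 1) 0 = ZetaNumerics.emCoeff (j + 1) :=
        fun j hj ↦ emCoeffTable_getD_succ hj
      have hCse : ∀ k < ms.length, Encl SK (progCoeffR q (ms.getD k 0) NK NUK) (Cs.getD k []) := by
        intro k hk
        obtain ⟨h1, h2⟩ := hmod.range _ (getD_mem hk)
        rw [hget k hk]
        refine progCoeffs_spec hS (E := EK) (len := LEN) (ν := NUK) hq h1 hcs hLs ?_
        have := hmod.facs_length
        rw [hLsl]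
        have : NK * q + ms.getD k 0 ≤ NK * q + q := by omega
        omega
      have hCl : ∀ k < ms.length, (Cs.getD k []).length = LEN + 1 := fun k hk ↦ by
        rw [hget k hk, length_progCoeffs]
      -- `ℓ`, `Re q`, the `lt`-rows, the `λ`-rows
      obtain ⟨hUl, hUe⟩ := ellList_spec hS hχ.ne_one (N := NK) (ν := NUK) (len := LEN) (by decide) (by decide)
        (r := rK) (by norm_num [rK]) (by norm_num [rK]) hmod.nodup (fun m hm ↦ (hmod.range m hm).2) hχ.vanishes
        hVχ hVl hCse hCsl hCl
      obtain ⟨hQl, hQe⟩ := qListC_spec hS hχ.ne_one hUe (c := IMAX) (by rw [hUl]; simp [LEN]) hQ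
      have hO := encl_oscRows χ hQe hQl (c := IMAX) le_rfl
      have hT := hTr χ
      rw [hχ.parity] at hT
      have hSum := encl_addL hT hO
      obtain ⟨hl1, hl2, hrows⟩ := checkRowsχ_spec SK c.rows _ _ h
      have hOl : (oscSeq Q (pascalNext (1 :: List.replicate IMAX 0)) IMAX).length = IMAX := length_oscSeq _ _ _
      have hi : n - 1 < c.rows.length := by rw [← hl2, hOl]; omega
      have hr := hrows (n - 1) hi
      have hx := hSum.getD (i := n - 1) (by rw [hl1]; exact hi)
      have hy := hO.getD (i := n - 1) (by rw [hOl]; omega)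
      simp only [show 1 + (n - 1) = n by omega] at hx hy
      exact rowOKχ_sound hS hx hy hr
    · simp at h
  · simp at h

/-- **SOUNDNESS OF THE MODULUS CERTIFICATE.**  If the kernel evaluates `runModulus q ms primes facs tr0 tr1 chars`
to `true` and the modulus data are sane (`ModulusOK`), then
(1) for every `CharSpec` `c` listed and every character `χ mod q` matching it, and every `1 ≤ n ≤ 48`:
`lb_χ(n) + lt_χ(n)` lies in the `λ`-row `n` of `c`, `lt_χ(n) = charLiOsc χ n` lies in the `lt`-row, and
`lb_χ(n) + lt_χ(n) > 0`;
(2) if `tr0` (resp. `tr1`) is non-empty, it encloses `lb_χ(n) = charLiTrend χ n`, `1 ≤ n ≤ 48`, for EVERY even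
(resp. odd) character `χ mod q`.  RH-FREE, GRH-FREE. -/
theorem runModulus_sound {ms : List ℕ} {primes : List ℕ} {facs : List (List (ℕ × ℕ))}
    {tr0 tr1 : List (ℕ × ℤ × ℤ)} {chars : List CharSpec}
    (h : runModulus q ms primes facs tr0 tr1 chars = true) (hmod : ModulusOK q ms facs) :
    (∀ c ∈ chars, ∀ χ : DirichletCharacter ℂ q, CharMatches q ms c χ → ∀ n, 1 ≤ n → n ≤ IMAX →
      InRow (charLiTrend χ n + charLiOsc χ n) (rowOf c.rows n).1 (rowOf c.rows n).2.1 (rowOf c.rows n).2.2.1 ∧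
        InRow (charLiOsc χ n) (rowOf c.rows n).1 (rowOf c.rows n).2.2.2.1 (rowOf c.rows n).2.2.2.2 ∧
        0 < charLiTrend χ n + charLiOsc χ n) ∧
    (tr0 ≠ [] → ∀ χ : DirichletCharacter ℂ q, charParity χ = 0 → ∀ n, 1 ≤ n → n ≤ IMAX →
      InRow (charLiTrend χ n) (rowOf tr0 n).1 (rowOf tr0 n).2.1 (rowOf tr0 n).2.2) ∧
    (tr1 ≠ [] → ∀ χ : DirichletCharacter ℂ q, charParity χ = 1 → ∀ n, 1 ≤ n → n ≤ IMAX →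
      InRow (charLiTrend χ n) (rowOf tr1 n).1 (rowOf tr1 n).2.1 (rowOf tr1 n).2.2) := by
  have hS : 0 < SK := by simp [SK]
  have hq : 0 < q := by have := hmod.one_lt; omega
  unfold runModulus at h
  split at h
  · rename_i L2 PI hL2 hPI
    split at h
    · rename_i PL hPL
      split at h
      · rename_i Ls LPI hLs hLPI
        simp only [Bool.and_eq_true, Bool.or_eq_true, List.all_eq_true] at h
        obtain ⟨⟨h0, h1⟩, hch⟩ := h
        have hL2m : MI.mem SK (Real.log 2) L2 := MI.mem_logTwo hS hL2
        have hPIm : MI.mem SK Real.pi PI := MI.mem_pi SK hPI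
        have hPLm := primeLogs_spec hS hL2m primes PL hPL
        obtain ⟨hLsl, hLse⟩ := logsFromFacs_spec hPLm facs 0 Ls hLs
        have hLse' : Encl SK (fun i ↦ Real.log ((i + 1 : ℕ) : ℝ)) Ls :=
          hLse.congr' fun i ↦ by simp [Nat.add_comm]
        have hLPIm := mem_logPiBox hS hPIm hL2m hLPI
        have hcs : ∀ j < NUZ, emCoeffTable.getD (j + 1) 0 = ZetaNumerics.emCoeff (j + 1) :=
          fun j hj ↦ emCoeffTable_getD_succ (lt_trans hj (by decide))
        obtain ⟨hZl, hZe⟩ := encl_zetaList SK (Nz := NZ) (νz := NUZ) (len := IMAX) (by decide) (by decide) hcs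
          emCoeffTable_length
        have hlogq : MI.mem SK (Real.log q) (Ls.getD (q - 1) zeroI) := by
          have := hLse'.getD (i := q - 1) (by
            rw [hLsl]
            have h1 : q ≤ facs.length := le_trans (Nat.le_add_left q (NK * q)) hmod.facs_length
            have := hmod.one_lt
            omega)
          rwa [show q - 1 + 1 = q by omega] at this
        -- the trend rows of both parities
        have hTr : ∀ χ : DirichletCharacter ℂ q, Encl SK (fun j ↦ charLiTrend χ (1 + j))
            (pickTrend (charParity χ) (trendRows (Ls.getD (q - 1) zeroI) LPI L2 (zetaList SK emCoeffTable NZ NUZ IMAX) 0)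
              (trendRows (Ls.getD (q - 1) zeroI) LPI L2 (zetaList SK emCoeffTable NZ NUZ IMAX) 1)) := by
          intro χ
          have hT := encl_trendRows (S := SK) hq χ hlogq hLPIm hL2m hZe hZl rfl
          have := charParity_le_one χ
          rcases Nat.le_one_iff_eq_zero_or_eq_one.1 this with h0' | h1'
          · rw [h0'] at hT ⊢; simpa [pickTrend] using hT
          · rw [h1'] at hT ⊢; simpa [pickTrend] using hT
        have hTl : ∀ a, (trendRows (Ls.getD (q - 1) zeroI) LPI L2 (zetaList SK emCoeffTable NZ NUZ IMAX) a).length = IMAX :=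
          fun a ↦ by simp [trendRows]
        refine ⟨fun c hc χ hχ n hn hn' ↦ charCheck_sound hmod hPIm hLse' hLsl hTr (hch c hc) hχ hn hn', ?_, ?_⟩
        · intro hne χ hpar n hn hn'
          rw [List.isEmpty_iff] at h0
          rcases h0 with h0 | h0
          · exact absurd h0 hne
          · obtain ⟨hl, hrows⟩ := checkBoxes_spec SK tr0 _ h0
            have hT := hTr χ
            rw [hpar, pickTrend, if_pos rfl] at hT
            have hi : n - 1 < tr0.length := by rw [← hl, hTl]; omega
            have hx := hT.getD (i := n - 1) (by rw [hTl]; omega)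
            simp only [show 1 + (n - 1) = n by omega] at hx
            exact boxOK_sound hS hx (hrows (n - 1) hi)
        · intro hne χ hpar n hn hn'
          rw [List.isEmpty_iff] at h1
          rcases h1 with h1 | h1
          · exact absurd h1 hne
          · obtain ⟨hl, hrows⟩ := checkBoxes_spec SK tr1 _ h1
            have hT := hTr χ
            rw [hpar, pickTrend, if_neg one_ne_zero] at hT
            have hi : n - 1 < tr1.length := by rw [← hl, hTl]; omega
            have hx := hT.getD (i := n - 1) (by rw [hTl]; omega)
            simp only [show 1 + (n - 1) = n by omega] at hx
            exact boxOK_sound hS hx (hrows (n - 1) hi)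
      · simp at h
    · simp at h
  · simp at h

/-- **The rows for a PRIMITIVE character** (`q > 1`): `Re λ_χ(n) = liCoeffCharRe χ n` (Bombieri–Lagarias' absolutely
convergent zero sum, `LiCriterionDirichlet.lean:95`) lies in the certified `λ`-row and is positive, and the
arithmetic part `charLiOsc χ n` lies in the `lt`-row — by T-D2s `liDirichletSplit_holds`. RH-FREE DATA; `n ≤ 48`
only; not evidence for GRH. -/
theorem liCoeffCharRe_mem_row_of_cert {ms : List ℕ} {primes : List ℕ} {facs : List (List (ℕ × ℕ))}
    {tr0 tr1 : List (ℕ × ℤ × ℤ)} {chars : List CharSpec}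
    (h : runModulus q ms primes facs tr0 tr1 chars = true) (hmod : ModulusOK q ms facs) {c : CharSpec}
    (hc : c ∈ chars) {χ : DirichletCharacter ℂ q} (hχ : CharMatches q ms c χ) (hprim : χ.IsPrimitive)
    {n : ℕ} (hn : 1 ≤ n) (hn' : n ≤ IMAX) :
    InRow (liCoeffCharRe χ n) (rowOf c.rows n).1 (rowOf c.rows n).2.1 (rowOf c.rows n).2.2.1 ∧
      InRow (charLiOsc χ n) (rowOf c.rows n).1 (rowOf c.rows n).2.2.2.1 (rowOf c.rows n).2.2.2.2 ∧
      0 < liCoeffCharRe χ n := by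
  rw [liDirichletSplit_holds q χ hprim hmod.one_lt n hn]
  exact (runModulus_sound h hmod).1 c hc χ hχ n hn hn'

end Summit.RiemannHypothesis.RiemannHypothesis.Theorems.LiDirichletKernel
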